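/-
Copyright (c) 2026 the pub-hodgecm-mathlib formalisation cell (harness21).  Prover seat hodgecm-mathlib-LH4-p13 (g2), req620 Track A «(D-RAM) FOUR-FRAME» squad
(heir LEAD F0P3a-plan lineage; dealer LH4-plan lineage; MS ROAD A, Stage B brick B4 «SPLIT STRATA» of SPEC `F0/P3c/LH4/LH4-p10/g2/SPEC-StageB.v1.LH4p10g2.md` §C,
FILE 1 of the brick: the stratum-independent TOOLS).  2026-09-04.
-/
import Summits.HodgeConjecture.HodgeConjecture.Theorems.F0P3cDyRamDiagonalTorusDefs                -- ★ DEFS LEAF (LH4-p11): `diagGLUnits`, `unitTorus`, `fixedUnitTorus`, `latticeStabilizer`, `unitStabilizer`, `fixedUnitStabilizer`, `stabiliserWeight`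
import Summits.HodgeConjecture.HodgeConjecture.Theorems.F0P3cDyRamDiagonalFixedBox                 -- ★ p855091∕F (LH4-p14): `pairing_diagonal_single_right`; brings ★ `UnitaryLatticeTreeDual` (`latt_mul_le_latt_iff`)
import Literature.NumberTheory.Automorphic.UnitaryLatticeTreeApartment                            -- ★ `dualLatt_eq_self_of_isSelfDualLattice`
import Literature.NumberTheory.LocalFields.RamifiedQuadraticResidueCountsUnits                    -- ★ B1 FILE 2 p855694 (F0P3-p01): (C3) `relIndex_unitLevel_eq`, (C4) `relIndex_fixedUnitLevel_eq`; brings `v_varpi_pow`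
import HarnessLib

/-!
# Crux `H413`, MS ROAD A, STAGE B brick B4 «SPLIT STRATA», FILE 1: STRATUM TOOLS — orbit-invariance of the weight, the coordinate-congruence indices
# `[𝒯 : 𝒯 ∩ {u_i ≡ u_j (𝔭^s)}] = (q−1)q^{s−1}`, `[𝒰 : 𝒰 ∩ {u_i ≡ u_j (𝔭_E^s)}] = (q−1)q^{⌈s∕2⌉−1}`, and three unimodular Gram blocks

Cell `hodgecm-mathlib` (D-0151), FLOOR 0, crux item H413 = `stmt-HodgeConjecture-24833`, route of record `HCCMUnconditional`; squad F0∕P3c∕LH4 (req618∕req620).  THEOREMS ONLY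
(no `def`, no instance, no notation, no `sorry`, default heartbeats); lane `--supports stmt-HodgeConjecture-24833 --as helper` (count-neutral).  Road target: tree
`Cruxes/H413/Lines/F0_P3c_DyRamFourFrame_U3_Laws.lean` stub `stub_U3_stableModelSum` (MS); paper proof = LH4-p10 (g2) MEMO-stableLaw-finite v2 §4 (T); Lean cut = SPEC-StageB v1 §C B4
(the on-branch strata `T_i(s)` contribute `q^{s∕2}` each).  This file holds what the three axes SHARE; the per-axis files (`F0P3cDyRamDiagonalSplitCount*`) import it.

WHAT IS PROVED (generic valued field `K`; `N` arbitrary unless stated; currency ★ `F0P3cDyRamDiagonalTorusDefs`).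
* §1 lattices: `latt (A·B) = latt A` for `B ∈ GL_N(𝒪)` (`latt_mul_eq_latt_of_isIntMatrix`; `g·latt A = latt (g·A)` is ★ `mapGL_latt_eq`, i.e. `rw [mapGL, latt_mul]`).
* §2 ORBIT-INVARIANCE: `latticeStabilizer (diag z · M) = latticeStabilizer M` for every `z ∈ (K^×)^N` (diagonal matrices commute), hence the same for `unitStabilizer`,
  `fixedUnitStabilizer σ` and **`stabiliserWeight σ (diag z · M) = stabiliserWeight σ M`** — the weight `1∕[𝒰 : S_F(M)]` of the (S-fin) count is constant on each unit-torus orbit;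
  `finsum_mem_eq_ncard_mul` (a finite sum of a constant) and `v_pow_le_v_pow_iff` (`|ϖ|^n ≤ |ϖ^m| ↔ m ≤ n`).
* §3 COORDINATE-CONGRUENCE INDICES (the stabilisers of all three on-branch strata have this shape): for `i ≠ j`, `s ≥ 1` and ANY subgroup `S` with
  `u ∈ S ↔ u ∈ 𝒯 ∧ |u_i − u_j| ≤ |ϖ^s|`: **`[𝒯 : S] = (q − 1)q^{s−1}`** (`relIndex_unitTorus_of_coordCongr`), and with `𝒰 = fixedUnitTorus σ N` in place of `𝒯`:
  **`[𝒰 : S] = (q − 1)q^{⌈s∕2⌉−1}`** (`relIndex_fixedUnitTorus_of_coordCongr`) — the character `u ↦ u_i u_j⁻¹` maps `𝒯` onto `𝒪^×` (resp. `𝒰` onto `𝒪_F^×`) with `S` the preimage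
  of `1 + 𝔭^s`, so Mathlib's `Subgroup.relIndex_comap` reduces both to ★ B1 (C3)∕(C4) (`relIndex_unitLevel_eq`, `relIndex_fixedUnitLevel_eq`, membership-letter currency).
* §4 PARITY OF AN AXIS DEPTH: if `M` is `diag(D)`-self-dual and its `i`-th axis is `M ∩ Ke_i = a𝒪·e_i` at a normalised slot (`pr_i M = 𝒪`), then `|D_i|·|a| = 1`
  (`v_mul_v_eq_one_of_isVertexLattice_zero_diagonal`: `a e_i ∈ M = M^♯` pairs integrally with a unit-slot member, and `D_i⁻¹e_i ∈ M^♯ = M`); with `a = ϖ^s` and the datum's parity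
  (`σ`-fixed elements have even valuation) **`2 ∣ s`** (`two_dvd_of_isDualisableLattice_of_axis`) — the on-branch strata of ODD depth carry no dualisable lattice.
* §5 GRAM BLOCKS (`N = 3`): a lattice `latt g` whose Gram matrix `(σg)ᵀHg` has one of the shapes `(0 a 0; b c 0; 0 0 e)`, `(e 0 0; 0 0 a; 0 b c)`, `(0 0 a; 0 e 0; b 0 c)` with
  `|a| = |b| = |e| = 1`, `|c| ≤ 1` is a type-`0` (self-dual) vertex lattice for `H` (integral, `det = −abe` a unit, explicit integral inverse) — the three on-branch Gram shapes.
HONEST LABEL.  Count-neutral (`--supports`); nothing printed is asserted; (MS) and the census laws stay PROVER TARGETS until B2–B7∕B9∕B10 land; `HC_CM` is proved only modulo the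
7 printed citations (2 remaining named inputs: hLiu418 = `stmt-HodgeConjecture-24832`, h413 = `stmt-HodgeConjecture-24833`) until rung 0 closes.

## References
* [Kottwitz1986BaseChangeUnits] R. E. Kottwitz, *Base change for unit elements of Hecke algebras*, Compositio Math. 60 (1986), §1 pp. 240–241 (orbital integrals of units as
  lattice counts modulo the torus).
* [Rogawski1990] J. D. Rogawski, *Automorphic Representations of Unitary Groups in Three Variables*, Ann. of Math. Stud. 123 (1990), §4.9 Prop. 4.9.1 (a) p. 55.
* [Serre1979] J.-P. Serre, *Local Fields*, GTM 67 (1979), Ch. IV §2 Prop. 6 (the filtration `Uⁿ` of the units and its indices).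
* [Serre1980Trees] J.-P. Serre, *Trees*, Springer (1980), Ch. II §1.1 (lattices `g·𝒪^N` and the diagonal action).
* [Jacobowitz1962] R. Jacobowitz, *Hermitian forms over local fields*, Amer. J. Math. 84 (1962), §4, §7 (Gram matrices, unimodular lattices).
-/

set_option autoImplicit false

noncomputable section

namespace Summit.HodgeConjecture.HodgeConjecture.Cruxes.H413.F0P3cDyRamDiagonalStratumTools

open Matrix
open Literature.NumberTheory.Automorphic Literature.NumberTheory.Automorphic.HermitianLattice
open Literature.NumberTheory.Automorphic.UnitaryLatticeTree
open Literature.NumberTheory.LocalFields.WildQuadraticDatum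
open Summit.HodgeConjecture.HodgeConjecture.Cruxes.H413.F0P3cDyRamDiagonalTorusDefs
open scoped Valued WithZero Matrix MatrixGroups

variable {K : Type*} [Field K] [Valued K ℤᵐ⁰] {N : ℕ}

/-! ## §1  Lattices of column-rescaled frames -/

/-- `latt (A·B) = latt A` for `A` invertible and `B ∈ GL_N(𝒪)` (both `B`, `B⁻¹` integral). [cite: Serre1980Trees, II §1.1] -/
theorem latt_mul_eq_latt_of_isIntMatrix {A B : Matrix (Fin N) (Fin N) K} (hA : IsUnit A.det) (hB : IsUnit B.det)
    (hBi : IsIntMatrix B) (hBi' : IsIntMatrix B⁻¹) : latt (A * B) = latt A := by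
  refine le_antisymm ((latt_mul_le_latt_iff hA B).2 hBi) ?_
  have hAB : IsUnit (A * B).det := by rw [Matrix.det_mul]; exact hA.mul hB
  have h := (latt_mul_le_latt_iff hAB B⁻¹).2 hBi'
  rwa [Matrix.mul_assoc, Matrix.mul_nonsing_inv _ hB, Matrix.mul_one] at h

/-! ## §2  Orbit-invariance of the diagonal stabiliser and of the weight -/

/-- **THE DIAGONAL STABILISER IS CONSTANT ALONG `(K^×)^N`-ORBITS**: `latticeStabilizer (diag z · M) = latticeStabilizer M` (diagonal matrices commute).
[cite: Kottwitz1986BaseChangeUnits, §1 pp. 240–241] -/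
theorem latticeStabilizer_mapGL_diagGLUnits (z : Fin N → Kˣ) (M : Submodule 𝒪[K] (Fin N → K)) :
    latticeStabilizer (mapGL (diagGLUnits z) M) = latticeStabilizer M := by
  ext u
  rw [mem_latticeStabilizer_iff, mem_latticeStabilizer_iff, ← mapGL_mul, ← map_mul, mul_comm, map_mul, mapGL_mul]
  exact (mapGL_injective (diagGLUnits z)).eq_iff

/-- The unit stabiliser `S̃` is constant along `(K^×)^N`-orbits. [cite: Kottwitz1986BaseChangeUnits, §1 pp. 240–241] -/
theorem unitStabilizer_mapGL_diagGLUnits (z : Fin N → Kˣ) (M : Submodule 𝒪[K] (Fin N → K)) :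
    F0P3cDyRamDiagonalTorusDefs.unitStabilizer (mapGL (diagGLUnits z) M) = F0P3cDyRamDiagonalTorusDefs.unitStabilizer M := by
  rw [F0P3cDyRamDiagonalTorusDefs.unitStabilizer, F0P3cDyRamDiagonalTorusDefs.unitStabilizer, latticeStabilizer_mapGL_diagGLUnits]

/-- The `σ`-fixed unit stabiliser `S_F` is constant along `(K^×)^N`-orbits. [cite: Rogawski1990, §4.9 Prop. 4.9.1 (a) p. 55] -/
theorem fixedUnitStabilizer_mapGL_diagGLUnits (σ : K →+* K) (z : Fin N → Kˣ) (M : Submodule 𝒪[K] (Fin N → K)) :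
    fixedUnitStabilizer σ (mapGL (diagGLUnits z) M) = fixedUnitStabilizer σ M := by
  rw [fixedUnitStabilizer, fixedUnitStabilizer, latticeStabilizer_mapGL_diagGLUnits]

/-- **THE WEIGHT `1∕[𝒰 : S_F(M)]` IS CONSTANT ALONG `(K^×)^N`-ORBITS** (so constant on every stratum of the (S-fin) count, these being unit-torus orbits).
[cite: Kottwitz1986BaseChangeUnits, §1 pp. 240–241] [cite: Rogawski1990, §4.9 Prop. 4.9.1 (a) p. 55] -/
theorem stabiliserWeight_mapGL_diagGLUnits (σ : K →+* K) (z : Fin N → Kˣ) (M : Submodule 𝒪[K] (Fin N → K)) :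
    stabiliserWeight σ (mapGL (diagGLUnits z) M) = stabiliserWeight σ M := by
  rw [stabiliserWeight, stabiliserWeight, fixedUnitStabilizer_mapGL_diagGLUnits]

omit [Valued K ℤᵐ⁰] in
/-- A finite sum of a function constant on a finite set: `∑ᶠ a ∈ S, f a = #S · c`. [folklore] -/
theorem finsum_mem_eq_ncard_mul {α : Type*} {S : Set α} (hS : S.Finite) (f : α → ℚ) (c : ℚ) (hf : ∀ a ∈ S, f a = c) :
    ∑ᶠ a ∈ S, f a = (S.ncard : ℚ) * c := by
  rw [finsum_mem_congr rfl hf, finsum_mem_eq_finite_toFinset_sum _ hS, Finset.sum_const, Set.ncard_eq_toFinset_card S hS, nsmul_eq_mul]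

/-- `|ϖ|^n ≤ |ϖ^m| ↔ m ≤ n` for a uniformiser `ϖ`. [cite: Serre1980Trees, II §1.1] -/
theorem v_pow_le_v_pow_iff {ϖ : K} (hϖ : Valued.v ϖ = WithZero.exp (-1 : ℤ)) (m n : ℕ) :
    Valued.v ϖ ^ n ≤ Valued.v (ϖ ^ m) ↔ m ≤ n := by
  rw [map_pow, v_varpi_pow hϖ, v_varpi_pow hϖ, WithZero.exp_le_exp]
  omega

/-! ## §3  The coordinate-congruence indices `[𝒯 : 𝒯 ∩ {u_i ≡ u_j}]` and `[𝒰 : 𝒰 ∩ {u_i ≡ u_j}]` -/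

/-- **`[𝒯 : S] = (q − 1)·q^{s−1}`** for any subgroup `S` cut out of the unit torus `𝒯 = (𝒪^×)^N` by ONE coordinate congruence `u_i ≡ u_j (mod 𝔭^s)` (`i ≠ j`, `s ≥ 1`):
the character `φ(u) = u_i u_j⁻¹` maps `𝒯` onto `𝒪^×` (section `t ↦ (…,1,t,1,…)`) and `S = 𝒯 ∩ φ⁻¹(1 + 𝔭^s)`, so `[𝒯 : S] = [𝒪^× : 1 + 𝔭^s]` (Mathlib `Subgroup.relIndex_comap`)
`= (q−1)q^{s−1}` by ★ B1 (C3). [cite: Serre1979, Ch. IV §2 Prop. 6] [cite: Kottwitz1986BaseChangeUnits, §1 pp. 240–241] -/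
theorem relIndex_unitTorus_of_coordCongr {ϖ : K} (hϖ : Valued.v ϖ = WithZero.exp (-1 : ℤ)) [Finite 𝓀[K]] {i j : Fin N} (hij : i ≠ j)
    {s : ℕ} (hs : 1 ≤ s) (S : Subgroup (Fin N → Kˣ)) (hS : ∀ u, u ∈ S ↔ u ∈ unitTorus K N ∧ Valued.v ((u i : K) - u j) ≤ Valued.v (ϖ ^ s)) :
    S.relIndex (unitTorus K N) = (Nat.card 𝓀[K] - 1) * Nat.card 𝓀[K] ^ (s - 1) := by
  have hvs : Valued.v (ϖ ^ s) = WithZero.exp (-(s : ℤ)) := by rw [map_pow, v_varpi_pow hϖ]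
  set φ : (Fin N → Kˣ) →* Kˣ := (Pi.evalMonoidHom (fun _ : Fin N => Kˣ) i) / (Pi.evalMonoidHom (fun _ : Fin N => Kˣ) j) with hφ
  have hφ_apply : ∀ u : Fin N → Kˣ, ((φ u : Kˣ) : K) = (u i : K) / (u j : K) := fun u => by
    rw [hφ, MonoidHom.div_apply, Pi.evalMonoidHom_apply, Pi.evalMonoidHom_apply, Units.val_div_eq_div_val]
  have hsec : ∀ t : Kˣ, φ (Function.update 1 i t) = t := fun t => by
    rw [hφ, MonoidHom.div_apply, Pi.evalMonoidHom_apply, Pi.evalMonoidHom_apply, Function.update_self, Function.update_of_ne hij.symm,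
      Pi.one_apply, div_one]
  have hsec𝒯 : ∀ t : Kˣ, Valued.v (t : K) = 1 → Function.update (1 : Fin N → Kˣ) i t ∈ unitTorus K N := fun t ht => by
    rw [mem_unitTorus_iff]; intro k
    rcases eq_or_ne k i with rfl | hk
    · rw [Function.update_self]; exact ht
    · rw [Function.update_of_ne hk, Pi.one_apply, Units.val_one, map_one]
  have hread : ∀ u : Fin N → Kˣ, u ∈ unitTorus K N →
      (Valued.v ((φ u : Kˣ) : K) = 1 ∧ (Valued.v (((φ u : Kˣ) : K) - 1) ≤ WithZero.exp (-(s : ℤ)) ↔ Valued.v ((u i : K) - u j) ≤ Valued.v (ϖ ^ s))) := by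
    intro u hu
    have hi := (mem_unitTorus_iff u).1 hu i
    have hj := (mem_unitTorus_iff u).1 hu j
    refine ⟨by rw [hφ_apply, map_div₀, hi, hj, div_one], ?_⟩
    rw [hφ_apply, div_sub_one (Units.ne_zero _), map_div₀, hj, div_one, hvs]
  have hU : ∀ t : Kˣ, t ∈ (unitTorus K N).map φ ↔ Valued.v (t : K) = 1 := by
    intro t
    constructor
    · rintro ⟨u, hu, rfl⟩
      exact (hread u hu).1
    · intro ht
      exact ⟨Function.update 1 i t, hsec𝒯 t ht, hsec t⟩
  have hUn : ∀ t : Kˣ, t ∈ S.map φ ↔ Valued.v (t : K) = 1 ∧ Valued.v ((t : K) - 1) ≤ WithZero.exp (-(s : ℤ)) := by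
    intro t
    constructor
    · rintro ⟨u, hu, rfl⟩
      obtain ⟨hu𝒯, hus⟩ := (hS u).1 hu
      exact ⟨(hread u hu𝒯).1, (hread u hu𝒯).2.2 hus⟩
    · rintro ⟨ht, hts⟩
      refine ⟨Function.update 1 i t, ?_, hsec t⟩
      rw [SetLike.mem_coe, hS]
      refine ⟨hsec𝒯 t ht, ?_⟩
      have h := (hread _ (hsec𝒯 t ht)).2
      rw [hsec t] at h
      exact h.1 hts
  have hcomap : (S.map φ).comap φ ⊓ unitTorus K N = S := by
    ext u
    rw [Subgroup.mem_inf, Subgroup.mem_comap, hS, hUn]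
    constructor
    · rintro ⟨⟨-, h⟩, hu⟩
      exact ⟨hu, ((hread u hu).2).1 h⟩
    · rintro ⟨hu, h⟩
      exact ⟨⟨(hread u hu).1, ((hread u hu).2).2 h⟩, hu⟩
  rw [← hcomap, Subgroup.inf_relIndex_right, Subgroup.relIndex_comap]
  exact relIndex_unitLevel_eq hϖ hU hs hUn

/-- **`[𝒰 : S] = (q − 1)·q^{⌈s∕2⌉−1}`** (`⌈s∕2⌉ = (s+1)∕2` in `ℕ`) for any subgroup `S` cut out of `𝒰 = (𝒪_F^×)^N` (`σ`-fixed unit vectors) by ONE coordinate congruence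
`u_i ≡ u_j (mod 𝔭_E^s)` (`i ≠ j`, `s ≥ 1`), for the ramified datum `(σ, ϖ, d)`: the same character maps `𝒰` onto `𝒪_F^×` with `S = 𝒰 ∩ φ⁻¹(1 + 𝔭_E^s)`, and ★ B1 (C4) counts
`[𝒪_F^× : 𝒪_F^× ∩ (1 + 𝔭_E^s)]`. [cite: Serre1979, Ch. IV §2 Prop. 6] [cite: Rogawski1990, §4.9 Prop. 4.9.1 (a) p. 55] -/
theorem relIndex_fixedUnitTorus_of_coordCongr {σ : K →+* K} (hσ : ∀ a, σ (σ a) = a) (hvσ : ∀ a, Valued.v (σ a) = Valued.v a)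
    (hfix : ∀ x : K, σ x = x → x ≠ 0 → ∃ n : ℤ, Valued.v x = WithZero.exp (2 * n)) {ϖ : K} (hϖ : Valued.v ϖ = WithZero.exp (-1 : ℤ))
    {d : ℕ} (hd : Valued.v (ϖ - σ ϖ) = Valued.v ϖ ^ d) [Finite 𝓀[K]] {i j : Fin N} (hij : i ≠ j) {s : ℕ} (hs : 1 ≤ s)
    (S : Subgroup (Fin N → Kˣ)) (hS : ∀ u, u ∈ S ↔ u ∈ fixedUnitTorus σ N ∧ Valued.v ((u i : K) - u j) ≤ Valued.v (ϖ ^ s)) :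
    S.relIndex (fixedUnitTorus σ N) = (Nat.card 𝓀[K] - 1) * Nat.card 𝓀[K] ^ ((s + 1) / 2 - 1) := by
  have hvs : Valued.v (ϖ ^ s) = WithZero.exp (-(s : ℤ)) := by rw [map_pow, v_varpi_pow hϖ]
  set φ : (Fin N → Kˣ) →* Kˣ := (Pi.evalMonoidHom (fun _ : Fin N => Kˣ) i) / (Pi.evalMonoidHom (fun _ : Fin N => Kˣ) j) with hφ
  have hφ_apply : ∀ u : Fin N → Kˣ, ((φ u : Kˣ) : K) = (u i : K) / (u j : K) := fun u => by
    rw [hφ, MonoidHom.div_apply, Pi.evalMonoidHom_apply, Pi.evalMonoidHom_apply, Units.val_div_eq_div_val]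
  have hsec : ∀ t : Kˣ, φ (Function.update 1 i t) = t := fun t => by
    rw [hφ, MonoidHom.div_apply, Pi.evalMonoidHom_apply, Pi.evalMonoidHom_apply, Function.update_self, Function.update_of_ne hij.symm,
      Pi.one_apply, div_one]
  have hsec𝒰 : ∀ t : Kˣ, σ (t : K) = t → Valued.v (t : K) = 1 → Function.update (1 : Fin N → Kˣ) i t ∈ fixedUnitTorus σ N := fun t hσt ht => by
    rw [mem_fixedUnitTorus_iff]
    refine ⟨fun k => ?_, fun k => ?_⟩
    · rcases eq_or_ne k i with rfl | hk
      · rw [Function.update_self]; exact ht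
      · rw [Function.update_of_ne hk, Pi.one_apply, Units.val_one, map_one]
    · rcases eq_or_ne k i with rfl | hk
      · rw [Function.update_self]; exact hσt
      · rw [Function.update_of_ne hk, Pi.one_apply, Units.val_one, map_one]
  have hread : ∀ u : Fin N → Kˣ, u ∈ fixedUnitTorus σ N →
      ((σ ((φ u : Kˣ) : K) = (φ u : Kˣ) ∧ Valued.v ((φ u : Kˣ) : K) = 1) ∧
        (Valued.v (((φ u : Kˣ) : K) - 1) ≤ WithZero.exp (-(s : ℤ)) ↔ Valued.v ((u i : K) - u j) ≤ Valued.v (ϖ ^ s))) := by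
    intro u hu
    obtain ⟨huv, huσ⟩ := (mem_fixedUnitTorus_iff σ u).1 hu
    refine ⟨⟨by rw [hφ_apply, map_div₀, huσ i, huσ j], by rw [hφ_apply, map_div₀, huv i, huv j, div_one]⟩, ?_⟩
    rw [hφ_apply, div_sub_one (Units.ne_zero _), map_div₀, huv j, div_one, hvs]
  have hU : ∀ t : Kˣ, t ∈ (fixedUnitTorus σ N).map φ ↔ σ (t : K) = t ∧ Valued.v (t : K) = 1 := by
    intro t
    constructor
    · rintro ⟨u, hu, rfl⟩
      exact (hread u hu).1
    · rintro ⟨hσt, ht⟩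
      exact ⟨Function.update 1 i t, hsec𝒰 t hσt ht, hsec t⟩
  have hUn : ∀ t : Kˣ, t ∈ S.map φ ↔ (σ (t : K) = t ∧ Valued.v (t : K) = 1) ∧ Valued.v ((t : K) - 1) ≤ WithZero.exp (-(s : ℤ)) := by
    intro t
    constructor
    · rintro ⟨u, hu, rfl⟩
      obtain ⟨hu𝒰, hus⟩ := (hS u).1 hu
      exact ⟨(hread u hu𝒰).1, (hread u hu𝒰).2.2 hus⟩
    · rintro ⟨⟨hσt, ht⟩, hts⟩
      refine ⟨Function.update 1 i t, ?_, hsec t⟩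
      rw [SetLike.mem_coe, hS]
      refine ⟨hsec𝒰 t hσt ht, ?_⟩
      have h := (hread _ (hsec𝒰 t hσt ht)).2
      rw [hsec t] at h
      exact h.1 hts
  have hcomap : (S.map φ).comap φ ⊓ fixedUnitTorus σ N = S := by
    ext u
    rw [Subgroup.mem_inf, Subgroup.mem_comap, hS, hUn]
    constructor
    · rintro ⟨⟨-, h⟩, hu⟩
      exact ⟨hu, ((hread u hu).2).1 h⟩
    · rintro ⟨hu, h⟩
      exact ⟨⟨(hread u hu).1, ((hread u hu).2).2 h⟩, hu⟩
  rw [← hcomap, Subgroup.inf_relIndex_right, Subgroup.relIndex_comap]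
  exact relIndex_fixedUnitLevel_eq hσ hvσ hfix hϖ hd hU hs hUn

/-! ## §4  Parity of an axis depth under dualisability -/

/-- **`|D_i|·|a| = 1` AT A NORMALISED AXIS.**  Let `M` be a type-`0` vertex lattice for `diag(D)` (`D_i ≠ 0`, `σ` valuation-preserving) whose `i`-th axis is `M ∩ K e_i = a𝒪·e_i`
(`a e_i ∈ M` and every `w e_i ∈ M` has `|w| ≤ |a|`) at a NORMALISED slot (`|m_i| ≤ 1` on `M`, `= 1` attained).  Then `|D_i|·|a| = 1`: `M = M^♯` (★ `dualLatt_eq_self_of_isSelfDualLattice`),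
`a e_i ∈ M^♯` pairs with a unit-slot member to `σ(m_i)D_i a ∈ 𝒪`, and `D_i⁻¹ e_i ∈ M^♯ = M` gives `|D_i⁻¹| ≤ |a|`. [cite: Jacobowitz1962, §4, §7] [cite: Kottwitz1986BaseChangeUnits, §1 pp. 240–241] -/
theorem v_mul_v_eq_one_of_isVertexLattice_zero_diagonal {σ : K →+* K} (hvσ : ∀ a, Valued.v (σ a) = Valued.v a) {ϖ : K} {D : Fin N → K}
    (hD : ∀ i, D i ≠ 0) {M : Submodule 𝒪[K] (Fin N → K)} (hM : IsVertexLattice σ ϖ (Matrix.diagonal D) 0 M) (i : Fin N) {a : K}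
    (ha : (Pi.single i a : Fin N → K) ∈ M) (hax : ∀ w : K, (Pi.single i w : Fin N → K) ∈ M → Valued.v w ≤ Valued.v a)
    (hle : ∀ m ∈ M, Valued.v (m i) ≤ 1) (hex : ∃ m ∈ M, Valued.v (m i) = 1) :
    Valued.v (D i) * Valued.v a = 1 := by
  have hH : IsUnit (Matrix.diagonal D).det := by
    rw [Matrix.det_diagonal]; exact (Finset.prod_ne_zero_iff.2 fun i _ => hD i).isUnit
  have hself : dualLatt σ (Matrix.diagonal D) M = M := dualLatt_eq_self_of_isSelfDualLattice hvσ hH hM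
  have hDi : Valued.v (D i) ≠ 0 := (Valuation.ne_zero_iff _).2 (hD i)
  refine le_antisymm ?_ ?_
  · obtain ⟨m, hm, hmi⟩ := hex
    have ha' : (Pi.single i a : Fin N → K) ∈ dualLatt σ (Matrix.diagonal D) M := by rw [hself]; exact ha
    have h := (mem_dualLatt σ _ M _).1 ha' m hm
    rw [F0P3cDyRamDiagonalFixedBox.pairing_diagonal_single_right, map_mul, map_mul, hvσ, hmi, one_mul] at h
    exact h
  · have hmem : (Pi.single i (D i)⁻¹ : Fin N → K) ∈ dualLatt σ (Matrix.diagonal D) M := by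
      rw [mem_dualLatt]
      intro m hm
      rw [F0P3cDyRamDiagonalFixedBox.pairing_diagonal_single_right, mul_assoc, mul_inv_cancel₀ (hD i), mul_one, hvσ]
      exact hle m hm
    rw [hself] at hmem
    have h := hax _ hmem
    rw [map_inv₀] at h
    calc (1 : ℤᵐ⁰) = Valued.v (D i) * (Valued.v (D i))⁻¹ := (mul_inv_cancel₀ hDi).symm
      _ ≤ Valued.v (D i) * Valued.v a := by gcongr

/-- **THE DEPTH OF A DUALISABLE ON-BRANCH LATTICE IS EVEN.**  For the ramified datum (`σ`-fixed non-zero elements have EVEN valuation, `|ϖ| = exp(−1)`): if `M` is dualisable and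
its `i`-th axis is `𝔭^s e_i` at a normalised slot, then `2 ∣ s` — the dualising diagonal entry `D_i` is `σ`-fixed with `|D_i| = |ϖ|^{−s}`.
[cite: Jacobowitz1962, §7] [cite: Rogawski1990, §4.9 Prop. 4.9.1 (a) p. 55] -/
theorem two_dvd_of_isDualisableLattice_of_axis {σ : K →+* K} (hvσ : ∀ a, Valued.v (σ a) = Valued.v a)
    (hfix : ∀ x : K, σ x = x → x ≠ 0 → ∃ n : ℤ, Valued.v x = WithZero.exp (2 * n)) {ϖ : K} (hϖ : Valued.v ϖ = WithZero.exp (-1 : ℤ))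
    {M : Submodule 𝒪[K] (Fin N → K)} (hM : IsDualisableLattice σ ϖ M) (i : Fin N) {s : ℕ}
    (ha : (Pi.single i (ϖ ^ s) : Fin N → K) ∈ M) (hax : ∀ w : K, (Pi.single i w : Fin N → K) ∈ M → Valued.v w ≤ Valued.v (ϖ ^ s))
    (hle : ∀ m ∈ M, Valued.v (m i) ≤ 1) (hex : ∃ m ∈ M, Valued.v (m i) = 1) : 2 ∣ s := by
  obtain ⟨D, hD, hV⟩ := hM
  have h := v_mul_v_eq_one_of_isVertexLattice_zero_diagonal hvσ (fun i => (hD i).2) hV i ha hax hle hex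
  obtain ⟨n, hn⟩ := hfix (D i) (hD i).1 (hD i).2
  rw [hn, map_pow, v_varpi_pow hϖ, ← WithZero.exp_add, ← WithZero.exp_zero, WithZero.exp_inj] at h
  exact ⟨n.toNat, by omega⟩

/-! ## §5  Three unimodular Gram blocks (`N = 3`) -/

/-- A type-`0` vertex certificate from a Gram matrix of the block shape `(0 a 0; b c 0; 0 0 e)` (`|a| = |b| = |e| = 1`, `|c| ≤ 1`): integral, `det = −abe` a unit, integral inverse
`(−c∕ab, 1∕b, 0; 1∕a, 0, 0; 0, 0, 1∕e)` — the Gram shape of the AXIS-3 stratum. [cite: Jacobowitz1962, §4, §7] -/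
theorem isVertexLattice_zero_of_gram_eq_block₃ {σ : K →+* K} {ϖ : K} (hϖ1 : Valued.v ϖ ≤ 1) {H : Matrix (Fin 3) (Fin 3) K}
    (g : GL (Fin 3) K) {a b c e : K} (hG : formCongr σ g H = !![0, a, 0; b, c, 0; 0, 0, e])
    (ha : Valued.v a = 1) (hb : Valued.v b = 1) (hc : Valued.v c ≤ 1) (he : Valued.v e = 1) :
    IsVertexLattice σ ϖ H 0 (latt (g : Matrix (Fin 3) (Fin 3) K)) := by
  have ha0 : a ≠ 0 := fun h => by rw [h, map_zero] at ha; exact zero_ne_one ha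
  have hb0 : b ≠ 0 := fun h => by rw [h, map_zero] at hb; exact zero_ne_one hb
  have he0 : e ≠ 0 := fun h => by rw [h, map_zero] at he; exact zero_ne_one he
  have hinv : (!![0, a, 0; b, c, 0; 0, 0, e] : Matrix (Fin 3) (Fin 3) K)⁻¹ = !![-c / (a * b), b⁻¹, 0; a⁻¹, 0, 0; 0, 0, e⁻¹] := by
    refine Matrix.inv_eq_right_inv ?_
    ext i j
    fin_cases i <;> fin_cases j <;> simp [Matrix.mul_apply, Fin.sum_univ_three]
    · exact mul_inv_cancel₀ ha0
    · field_simp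
      ring
    · exact mul_inv_cancel₀ hb0
    · exact mul_inv_cancel₀ he0
  have key : ∀ t : K, Valued.v t ≤ 1 → Valued.v (ϖ * t) ≤ 1 := fun t ht => by rw [map_mul]; exact mul_le_one' hϖ1 ht
  refine ⟨g, rfl, ?_, ?_, ?_⟩
  · rw [hG]; intro i j
    fin_cases i <;> fin_cases j <;> simp [ha.le, hb.le, hc, he.le]
  · rw [hG, hinv]; intro i j
    rw [Matrix.smul_apply, smul_eq_mul]
    apply key
    fin_cases i <;> fin_cases j <;> simp [map_div₀, map_mul, map_inv₀, ha, hb, hc, he]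
  · rw [hG, pow_zero, Matrix.det_fin_three]
    simp [map_mul, ha, hb, he]

/-- The same for the block shape `(e 0 0; 0 0 a; 0 b c)` — the Gram shape of the AXIS-1 stratum; inverse `(1∕e, 0, 0; 0, −c∕ab, 1∕b; 0, 1∕a, 0)`. [cite: Jacobowitz1962, §4, §7] -/
theorem isVertexLattice_zero_of_gram_eq_block₁ {σ : K →+* K} {ϖ : K} (hϖ1 : Valued.v ϖ ≤ 1) {H : Matrix (Fin 3) (Fin 3) K}
    (g : GL (Fin 3) K) {a b c e : K} (hG : formCongr σ g H = !![e, 0, 0; 0, 0, a; 0, b, c])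
    (ha : Valued.v a = 1) (hb : Valued.v b = 1) (hc : Valued.v c ≤ 1) (he : Valued.v e = 1) :
    IsVertexLattice σ ϖ H 0 (latt (g : Matrix (Fin 3) (Fin 3) K)) := by
  have ha0 : a ≠ 0 := fun h => by rw [h, map_zero] at ha; exact zero_ne_one ha
  have hb0 : b ≠ 0 := fun h => by rw [h, map_zero] at hb; exact zero_ne_one hb
  have he0 : e ≠ 0 := fun h => by rw [h, map_zero] at he; exact zero_ne_one he
  have hinv : (!![e, 0, 0; 0, 0, a; 0, b, c] : Matrix (Fin 3) (Fin 3) K)⁻¹ = !![e⁻¹, 0, 0; 0, -c / (a * b), b⁻¹; 0, a⁻¹, 0] := by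
    refine Matrix.inv_eq_right_inv ?_
    ext i j
    fin_cases i <;> fin_cases j <;> simp [Matrix.mul_apply, Fin.sum_univ_three]
    · exact mul_inv_cancel₀ he0
    · exact mul_inv_cancel₀ ha0
    · field_simp
      ring
    · exact mul_inv_cancel₀ hb0
  have key : ∀ t : K, Valued.v t ≤ 1 → Valued.v (ϖ * t) ≤ 1 := fun t ht => by rw [map_mul]; exact mul_le_one' hϖ1 ht
  refine ⟨g, rfl, ?_, ?_, ?_⟩
  · rw [hG]; intro i j
    fin_cases i <;> fin_cases j <;> simp [ha.le, hb.le, hc, he.le]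
  · rw [hG, hinv]; intro i j
    rw [Matrix.smul_apply, smul_eq_mul]
    apply key
    fin_cases i <;> fin_cases j <;> simp [map_div₀, map_mul, map_inv₀, ha, hb, hc, he]
  · rw [hG, pow_zero, Matrix.det_fin_three]
    simp [map_mul, ha, hb, he]

/-- The same for the block shape `(0 0 a; 0 e 0; b 0 c)` — the Gram shape of the AXIS-2 stratum; inverse `(−c∕ab, 0, 1∕b; 0, 1∕e, 0; 1∕a, 0, 0)`. [cite: Jacobowitz1962, §4, §7] -/
theorem isVertexLattice_zero_of_gram_eq_block₂ {σ : K →+* K} {ϖ : K} (hϖ1 : Valued.v ϖ ≤ 1) {H : Matrix (Fin 3) (Fin 3) K}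
    (g : GL (Fin 3) K) {a b c e : K} (hG : formCongr σ g H = !![0, 0, a; 0, e, 0; b, 0, c])
    (ha : Valued.v a = 1) (hb : Valued.v b = 1) (hc : Valued.v c ≤ 1) (he : Valued.v e = 1) :
    IsVertexLattice σ ϖ H 0 (latt (g : Matrix (Fin 3) (Fin 3) K)) := by
  have ha0 : a ≠ 0 := fun h => by rw [h, map_zero] at ha; exact zero_ne_one ha
  have hb0 : b ≠ 0 := fun h => by rw [h, map_zero] at hb; exact zero_ne_one hb
  have he0 : e ≠ 0 := fun h => by rw [h, map_zero] at he; exact zero_ne_one he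
  have hinv : (!![0, 0, a; 0, e, 0; b, 0, c] : Matrix (Fin 3) (Fin 3) K)⁻¹ = !![-c / (a * b), 0, b⁻¹; 0, e⁻¹, 0; a⁻¹, 0, 0] := by
    refine Matrix.inv_eq_right_inv ?_
    ext i j
    fin_cases i <;> fin_cases j <;> simp [Matrix.mul_apply, Fin.sum_univ_three]
    · exact mul_inv_cancel₀ ha0
    · exact mul_inv_cancel₀ he0
    · field_simp
      ring
    · exact mul_inv_cancel₀ hb0
  have key : ∀ t : K, Valued.v t ≤ 1 → Valued.v (ϖ * t) ≤ 1 := fun t ht => by rw [map_mul]; exact mul_le_one' hϖ1 ht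
  refine ⟨g, rfl, ?_, ?_, ?_⟩
  · rw [hG]; intro i j
    fin_cases i <;> fin_cases j <;> simp [ha.le, hb.le, hc, he.le]
  · rw [hG, hinv]; intro i j
    rw [Matrix.smul_apply, smul_eq_mul]
    apply key
    fin_cases i <;> fin_cases j <;> simp [map_div₀, map_mul, map_inv₀, ha, hb, hc, he]
  · rw [hG, pow_zero, Matrix.det_fin_three]
    simp [map_mul, ha, hb, he]

end Summit.HodgeConjecture.HodgeConjecture.Cruxes.H413.F0P3cDyRamDiagonalStratumTools

end
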